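import Mathlib
import HarnessLib
import Literature.Analysis.Convex.KrasnoselskijIteration
import Literature.Analysis.Convex.ProximalMap
import Literature.Analysis.Convex.ConvexMetricProjection
import Literature.Analysis.Convex.BaillonHaddad

/-!
# Averaged nonexpansive operators; forward–backward (proximal gradient) and projected gradient

Literature anchor (convex analysis / first-order methods). `E` is a real inner product space
(a Hilbert space where completeness is needed, finite-dimensional for `prox` and for the
convergence statements).

## Averaged operators [CY15]

* `IsAveraged α T` ([CY15, Def. 1.1]): `T = (1 − α) I + α R` for a nonexpansive `R`; the
  dictionary to `Literature.Analysis.Convex.KrasnoselskijIteration` is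
  `isAveraged_averagedMap` / `IsAveraged.exists_eq_averagedMap` (`T = averagedMap R α`).
* THE CHARACTERISATIONS [CY15, Prop. 2.1 (i)⇔(ii)⇔(iii)⇔(iv)]: `isAveraged_iff_norm_sub_le`
  (`(1 − 1/α) I + (1/α) T` nonexpansive), `isAveraged_iff_norm_sq`
  (`α‖Tx − Ty‖² + (1 − α)‖(I − T)x − (I − T)y‖² ≤ α‖x − y‖²`), `isAveraged_iff_inner`
  (`‖Tx − Ty‖² + (1 − 2α)‖x − y‖² ≤ 2(1 − α)⟪x − y, Tx − Ty⟫`); consequences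
  `IsAveraged.norm_sub_le` (nonexpansive), `IsAveraged.mono`, `isAveraged_one_iff`,
  `isAveraged_half_iff` (`1/2`-averaged = firmly nonexpansive) and
  `isAveraged_half_iff_isCocoercive_one`.
* EXAMPLES: `isAveraged_half_prox` (proximal map, `prox_f = J_{∂f}` [CY15, §4]),
  `isAveraged_half_proj` (metric projection [Deu01, Thm 5.5 (2)]),
  `isAveraged_forwardStep_of_isCocoercive` (`I − γB` is `γ/(2μ)`-averaged for `μ`-cocoercive
  `B` [CY15, proof of Prop. 4.4]), `isAveraged_gradientStep` (`I − γ∇f` is `γL/2`-averaged for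
  convex `f` with `L`-Lipschitz gradient — Baillon–Haddad,
  `Literature.Analysis.Convex.BaillonHaddad.isCocoercive_of_convexOn`; [BC10, Remark 2.2 (c)]).
* COMPOSITION AND CONVEX COMBINATION [CY15, Prop. 2.4 and Prop. 2.2] (both due to
  Ogura–Yamada 2002 in the case of two operators, cf. [CY15, Remark 2.3 and before Prop. 2.4]):
  `IsAveraged.comp` — `T₁ ∘ T₂` is `(α₁ + α₂ − 2α₁α₂)/(1 − α₁α₂)`-averaged — with the special case
  `IsAveraged.comp_half` (`2/3`), and `IsAveraged.convexCombo`.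
* CONVERGENCE OF PICARD ITERATES (proper, e.g. finite-dimensional, `E`):
  `IsAveraged.exists_tendsto_iterate` — for `0 < α < 1` and `Fix T ≠ ∅`, `Tⁿ x₀` converges to a
  fixed point (it IS the Krasnosel'skiĭ–Mann iteration of `R`,
  `KrasnoselskijIteration.exists_tendsto_kmIter`; [CY15, Prop. 3.4 (iii)] with `T_n ≡ T`,
  `λ_n ≡ 1`, `e_n ≡ 0`, strong convergence because `dim E < ∞`).

## Fermat's rule for `f₁ + f₂` with `f₂` differentiable [HUL01, Car21]

`isMinOn_add_iff_hasSubgradientWithinAt_neg`: for `f₁, f₂` convex on a convex set `s`, `x ∈ s`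
and `f₂` with gradient `g x` at `x`, `x ∈ argmin_s (f₁ + f₂) ⟺ −g x ∈ ∂f₁(x)` (subgradient
relative to `s`, `Literature.Analysis.Convex.HasSubgradientWithinAt`); necessity
(`hasSubgradientWithinAt_neg_of_isMinOn_add`, slope argument along segments) needs only `f₁`
convex, sufficiency (`isMinOn_add_of_hasSubgradientWithinAt_neg`) only `f₂` convex. For finite
convex functions on `ℝⁿ` this is [HUL01, D Thm 2.2.1 with Thm 4.1.1 and Cor 2.1.4]
(`0 ∈ ∂(f₁ + f₂)(x) = ∂f₁(x) + {∇f₂(x)}`); the smooth constrained case `f₁ = 0` is the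
variational inequality `isMinOn_iff_inner_nonneg` [Car21, Lemma 6.2].

## Forward–backward and projected gradient (finite dimension) [CY15 §4, Car21 §7.3–7.4, Com18 §4.1]

* `fbStep γ f₁ g x = prox_{γf₁}(x − γ g x)` ([Car21, (7.52)], "ISTA"; [CY15, Prop. 4.7] with
  `λ_n ≡ 1`, no errors). FIXED POINTS: `fbStep_eq_self_iff` (`⟺ −g x ∈ ∂f₁(x)`, i.e.
  `zer(∂f₁ + ∇f₂) = Fix(prox_{γf₁} ∘ (I − γ∇f₂))`, [CY15, proof of Prop. 4.4; Car21, §7.4.1]) and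
  `fbStep_eq_self_iff_isMinOn` (`⟺ x ∈ argmin (f₁ + f₂)`). REGULARITY: `norm_fbStep_sub_fbStep_le`
  (nonexpansive for `0 ≤ γ ≤ 2/L`) and `isAveraged_fbStep` — `2/(4 − γL)`-AVERAGED for
  `0 < γ < 2/L` ([CY15, Remark 4.6: "`T = J_{γA}(I − γB)` is `α`-averaged … with the sharper
  constant `α = 2β/(4β − γ)` of [Ogur02]"; [Com18, §4.1]). CONVERGENCE:
  `exists_isMinOn_tendsto_iterate_fbStep` — [CY15, Prop. 4.7 (iii)] RESTRICTED to `dim E < ∞`,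
  finite-valued convex `f₁` (our `prox`), constant step `γ ∈ ]0, 2/L[`, `λ_n ≡ 1`, `a_n = b_n = 0`.
* `projGradStep γ K g x = P_K(x − γ g x)` [Car21, (7.17)]: `projGradStep_eq_self_iff` (fixed
  points = solutions of the variational inequality, [Car21, (7.16)]),
  `projGradStep_eq_self_iff_isMinOn` (= constrained minimisers, with [Car21, Lemma 6.2]),
  `isAveraged_projGradStep` (`2/(4 − γL)`-averaged: the case `A = N_K`, `J_{γN_K} = P_K` of the
  above), `exists_isMinOn_tendsto_iterate_projGradStep` (convergence to a constrained minimiser for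
  convex `f` — [Car21, Thm 7.3] assumes strong convexity and gets a contraction; here
  averagedness replaces it, as in [CY15, Prop. 4.4 (iii)] with `A = N_K`).

NOT COVERED (deliberately): weak convergence / infinite-dimensional Fejér arguments, variable
steps `γ_n`, relaxations `λ_n ≠ 1`, error sequences, `f₁ ∈ Γ₀` with extended values, rates.

Sources (lit store): [CY15] P. L. Combettes, I. Yamada, *Compositions and convex combinations
of averaged nonexpansive operators*, J. Math. Anal. Appl. 425 (2015) 55–70 = arXiv:1407.5100
(`paper:arxiv-1407.5100`: Def. 1.1 p. 3; Props. 2.1, 2.2, 2.4 p. 4; Prop. 3.4 p. 7; §4,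
Cor. 4.1 p. 10; Prop. 4.4 and its proof p. 11; Remark 4.6, Prop. 4.7 p. 12);
[Car21] G. Carlier, *Classical and Modern Optimization*, World Scientific 2021
(`book:carlier2021-classical-modern-optimization`: Lemma 6.2 PDF p. 172; §7.3 (7.15)–(7.17),
Thm 7.3 PDF p. 209; §7.4.1 (7.51)–(7.52) PDF pp. 217–218); [HUL01] J.-B. Hiriart-Urruty,
C. Lemaréchal, *Fundamentals of Convex Analysis*, Springer 2001
(`book:hiriart-urruty2001-fundamentals-convex-analysis`: D Cor. 2.1.4 PDF p. 174, D Thm 2.2.1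
PDF p. 176, D Thm 4.1.1 PDF p. 181); [Com18] P. L. Combettes, *Monotone operator theory in convex
optimization*, Math. Program. B170 (2018) = arXiv:1802.02694 (§4.1, PDF p. 11); [BC10]
H. H. Bauschke, P. L. Combettes, *The Baillon–Haddad theorem revisited*, J. Convex Anal. 17
(2010) = arXiv:0906.0807 (Remark 2.2 (c), PDF pp. 4–5); [WW22] D. Wachsmuth, G. Wachsmuth,
arXiv:2204.00282 (Lemma 2.3, PDF p. 4); [Deu01] F. Deutsch, *Best Approximation in Inner Product
Spaces*, Springer 2001 (Thm 5.5).
-/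

noncomputable section

open Set Filter Topology InnerProductSpace
open scoped RealInnerProductSpace NNReal

namespace Literature.Analysis.Convex.AveragedOperators

open KrasnoselskijIteration ConvexMetricProjection BaillonHaddad

variable {E : Type*} [NormedAddCommGroup E] [InnerProductSpace ℝ E]

/-! ## Averaged operators -/

/-- `T` is **`α`-averaged**: `T = (1 − α) I + α R` for some nonexpansive `R : E → E`
([CY15, Def. 1.1], where `α ∈ ]0,1[`; here `α` is any real number and the range hypotheses are
carried by the lemmas — `α = 1` means nonexpansive, `α = 1/2` firmly nonexpansive).
[cite: CombettesYamada2015, Def 1.1] -/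
def IsAveraged (α : ℝ) (T : E → E) : Prop :=
  ∃ R : E → E, (∀ x y, ‖R x - R y‖ ≤ ‖x - y‖) ∧ ∀ x, T x = (1 - α) • x + α • R x

variable {T T₁ T₂ R : E → E} {α α₁ α₂ β : ℝ} {x y : E}

/-- Transport along an equality of constants. [cite: CombettesYamada2015, Def 1.1] -/
theorem IsAveraged.of_eq (h : IsAveraged α T) (e : α = β) : IsAveraged β T := e ▸ h

/-- The averaged map `(1 − t) I + t R` of a nonexpansive `R` is `t`-averaged (by definition).
[cite: CombettesYamada2015, Def 1.1] -/
theorem isAveraged_averagedMap (hR : ∀ x y, ‖R x - R y‖ ≤ ‖x - y‖) (t : ℝ) :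
    IsAveraged t (averagedMap R t) :=
  ⟨R, hR, fun _ => rfl⟩

/-- An `α`-averaged map IS an averaged map `averagedMap R α` of a nonexpansive `R`
(the dictionary to `Literature.Analysis.Convex.KrasnoselskijIteration`).
[cite: CombettesYamada2015, Def 1.1] -/
theorem IsAveraged.exists_eq_averagedMap (h : IsAveraged α T) :
    ∃ R : E → E, (∀ x y, ‖R x - R y‖ ≤ ‖x - y‖) ∧ T = averagedMap R α := by
  obtain ⟨R, hR, hT⟩ := h
  exact ⟨R, hR, funext fun x => hT x⟩

/-- A nonexpansive map is `1`-averaged and conversely. [cite: CombettesYamada2015, Def 1.1] -/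
theorem isAveraged_one_iff : IsAveraged 1 T ↔ ∀ x y, ‖T x - T y‖ ≤ ‖x - y‖ := by
  constructor
  · rintro ⟨R, hR, hT⟩ x y
    have ex : T x = R x := by rw [hT x]; simp
    have ey : T y = R y := by rw [hT y]; simp
    rw [ex, ey]; exact hR x y
  · intro h
    exact ⟨T, h, fun x => by simp⟩

/-- An `α`-averaged map with `0 ≤ α ≤ 1` is nonexpansive. [cite: CombettesYamada2015, Def 1.1] -/
theorem IsAveraged.norm_sub_le (h : IsAveraged α T) (hα0 : 0 ≤ α) (hα1 : α ≤ 1) (x y : E) :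
    ‖T x - T y‖ ≤ ‖x - y‖ := by
  obtain ⟨R, hR, rfl⟩ := h.exists_eq_averagedMap
  exact norm_averagedMap_sub_averagedMap_le hR hα0 hα1 x y

/-- The expansion `‖a • d + b • e‖² = a²‖d‖² + 2ab⟪d, e⟫ + b²‖e‖²`. [folklore] -/
private theorem norm_sq_smul_add_smul (a b : ℝ) (d e : E) :
    ‖a • d + b • e‖ ^ 2 = a ^ 2 * ‖d‖ ^ 2 + 2 * a * b * ⟪d, e⟫ + b ^ 2 * ‖e‖ ^ 2 := by
  rw [norm_add_sq_real, norm_smul, norm_smul, real_inner_smul_left, real_inner_smul_right,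
    Real.norm_eq_abs, Real.norm_eq_abs, mul_pow, mul_pow, sq_abs, sq_abs]
  ring

/-- [CY15, Prop. 2.1 (i)⇔(ii)]: for `α ≠ 0`, `T` is `α`-averaged iff
`(1 − 1/α) I + (1/α) T` is nonexpansive. [cite: CombettesYamada2015, Prop 2.1 (i)⇔(ii)] -/
theorem isAveraged_iff_norm_sub_le (hα : α ≠ 0) :
    IsAveraged α T ↔ ∀ x y,
      ‖((1 - 1 / α) • x + (1 / α) • T x) - ((1 - 1 / α) • y + (1 / α) • T y)‖ ≤ ‖x - y‖ := by
  constructor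
  · rintro ⟨R, hR, hT⟩ x y
    have e : ∀ z, (1 - 1 / α) • z + (1 / α) • T z = R z := fun z => by
      rw [hT z, smul_add, smul_smul, smul_smul, ← add_assoc, ← add_smul]
      have h1 : 1 - 1 / α + 1 / α * (1 - α) = 0 := by
        rw [mul_sub, mul_one, one_div_mul_cancel hα]; ring
      have h2 : 1 / α * α = 1 := one_div_mul_cancel hα
      rw [h1, h2, zero_smul, zero_add, one_smul]
    rw [e x, e y]; exact hR x y
  · intro h
    refine ⟨fun z => (1 - 1 / α) • z + (1 / α) • T z, h, fun z => ?_⟩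
    rw [smul_add, smul_smul, smul_smul, ← add_assoc, ← add_smul]
    have h1 : 1 - α + α * (1 - 1 / α) = 0 := by
      rw [mul_sub, mul_one, mul_one_div_cancel hα]; ring
    have h2 : α * (1 / α) = 1 := mul_one_div_cancel hα
    rw [h1, h2, zero_smul, zero_add, one_smul]

/-- [CY15, Prop. 2.1 (i)⇔(iv)]: for `α > 0`, `T` is `α`-averaged iff
`‖T x − T y‖² + (1 − 2α)‖x − y‖² ≤ 2(1 − α)⟪x − y, T x − T y⟫` for all `x, y`.
[cite: CombettesYamada2015, Prop 2.1 (i)⇔(iv)] -/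
theorem isAveraged_iff_inner (hα : 0 < α) :
    IsAveraged α T ↔ ∀ x y,
      ‖T x - T y‖ ^ 2 + (1 - 2 * α) * ‖x - y‖ ^ 2 ≤ 2 * (1 - α) * ⟪x - y, T x - T y⟫ := by
  -- the identity `‖(Tx − Ty) − (1 − α)(x − y)‖² = ‖Tx − Ty‖² − 2(1 − α)⟪x − y, Tx − Ty⟫ + (1 − α)²‖x − y‖²`
  have key : ∀ x y, ‖(T x - T y) - (1 - α) • (x - y)‖ ^ 2 = ‖T x - T y‖ ^ 2
      - 2 * (1 - α) * ⟪x - y, T x - T y⟫ + (1 - α) ^ 2 * ‖x - y‖ ^ 2 := by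
    intro x y
    rw [norm_sub_sq_real, norm_smul, real_inner_smul_right, Real.norm_eq_abs, mul_pow, sq_abs,
      real_inner_comm (x - y) (T x - T y)]
    ring
  constructor
  · rintro ⟨R, hR, hT⟩ x y
    have e : (T x - T y) - (1 - α) • (x - y) = α • (R x - R y) := by
      rw [hT x, hT y]; simp only [smul_sub]; abel
    have h1 : ‖(T x - T y) - (1 - α) • (x - y)‖ ^ 2 ≤ α ^ 2 * ‖x - y‖ ^ 2 := by
      rw [e, norm_smul, mul_pow, Real.norm_eq_abs, sq_abs]
      exact mul_le_mul_of_nonneg_left (pow_le_pow_left₀ (norm_nonneg _) (hR x y) 2) (sq_nonneg α)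
    rw [key] at h1
    nlinarith [h1]
  · intro h
    refine ⟨fun z => (1 / α) • (T z - (1 - α) • z), fun x y => ?_, fun z => ?_⟩
    · have e : (1 / α) • (T x - (1 - α) • x) - (1 / α) • (T y - (1 - α) • y) =
          (1 / α) • ((T x - T y) - (1 - α) • (x - y)) := by
        simp only [smul_sub]; abel
      rw [e, norm_smul, Real.norm_of_nonneg (by positivity : (0:ℝ) ≤ 1 / α),
        ← sq_le_sq₀ (by positivity) (norm_nonneg _), mul_pow, key]
      rw [show (1 / α) ^ 2 * (‖T x - T y‖ ^ 2 - 2 * (1 - α) * ⟪x - y, T x - T y⟫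
          + (1 - α) ^ 2 * ‖x - y‖ ^ 2) = (‖T x - T y‖ ^ 2 - 2 * (1 - α) * ⟪x - y, T x - T y⟫
          + (1 - α) ^ 2 * ‖x - y‖ ^ 2) / α ^ 2 by ring, div_le_iff₀ (by positivity)]
      nlinarith [h x y]
    · show T z = (1 - α) • z + α • ((1 / α) • (T z - (1 - α) • z))
      rw [smul_smul, mul_one_div_cancel hα.ne', one_smul]
      abel

/-- [CY15, Prop. 2.1 (i)⇔(iii)] (multiplied through by `α`): for `α > 0`, `T` is `α`-averaged iff
`α‖T x − T y‖² + (1 − α)‖(x − T x) − (y − T y)‖² ≤ α‖x − y‖²` for all `x, y`.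
[cite: CombettesYamada2015, Prop 2.1 (i)⇔(iii)] -/
theorem isAveraged_iff_norm_sq (hα : 0 < α) :
    IsAveraged α T ↔ ∀ x y,
      α * ‖T x - T y‖ ^ 2 + (1 - α) * ‖(x - T x) - (y - T y)‖ ^ 2 ≤ α * ‖x - y‖ ^ 2 := by
  rw [isAveraged_iff_inner hα]
  refine forall_congr' fun x => forall_congr' fun y => ?_
  have e : (x - T x) - (y - T y) = (x - y) - (T x - T y) := by abel
  have e2 : ‖(x - y) - (T x - T y)‖ ^ 2 = ‖x - y‖ ^ 2 - 2 * ⟪x - y, T x - T y⟫ + ‖T x - T y‖ ^ 2 :=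
    norm_sub_sq_real _ _
  rw [e, e2]
  constructor <;> intro h <;> nlinarith [h]

/-- Monotonicity in the constant: an `α`-averaged map is `β`-averaged for `0 < α ≤ β ≤ 1`.
[cite: CombettesYamada2015, Prop 2.1] -/
theorem IsAveraged.mono (h : IsAveraged α T) (hα : 0 < α) (hαβ : α ≤ β) (hβ : β ≤ 1) :
    IsAveraged β T := by
  rw [isAveraged_iff_norm_sq hα] at h
  rw [isAveraged_iff_norm_sq (hα.trans_le hαβ)]
  intro x y
  have h1 := h x y
  have hq : 0 ≤ ‖(x - T x) - (y - T y)‖ ^ 2 := by positivity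
  have hd : ‖T x - T y‖ ^ 2 ≤ ‖x - y‖ ^ 2 := by nlinarith
  nlinarith

/-- FIRMLY NONEXPANSIVE = `1/2`-AVERAGED: `T` is `1/2`-averaged iff
`‖T x − T y‖² ≤ ⟪x − y, T x − T y⟫` for all `x, y` ([CY15, Prop. 2.1 (iv)] with `α = 1/2`;
[CY15, §4 / proof of Prop. 4.4]: resolvents `J_A` of monotone `A` are `1/2`-averaged).
[cite: CombettesYamada2015, Prop 2.1 (iv) (α = 1/2) and §4 (J_A firmly nonexpansive)] -/
theorem isAveraged_half_iff : IsAveraged (1 / 2) T ↔ ∀ x y, ‖T x - T y‖ ^ 2 ≤ ⟪x - y, T x - T y⟫ := by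
  rw [isAveraged_iff_inner (by norm_num : (0:ℝ) < 1 / 2)]
  refine forall_congr' fun x => forall_congr' fun y => ?_
  constructor <;> intro h <;> linarith

/-- Dictionary to `Literature.Analysis.Convex.BaillonHaddad.IsCocoercive`: `1/2`-averaged iff
`1`-cocoercive. [cite: CombettesYamada2015, Prop 2.1 (iv) (α = 1/2)] -/
theorem isAveraged_half_iff_isCocoercive_one : IsAveraged (1 / 2) T ↔ IsCocoercive 1 T := by
  simp only [isAveraged_half_iff, IsCocoercive, one_mul]

/-! ### Examples: proximal maps, projections, cocoercive (gradient) steps -/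

/-- The proximal map of a convex function (finite dimension) is `1/2`-averaged
([CY15, §4]: `prox_f = J_{∂f}` is firmly nonexpansive; [BC10, §2]).
[cite: CombettesYamada2015, §4 (prox_f = J_{∂f} firmly nonexpansive); BauschkeCombettes2010, §2 (prox_φ is firmly nonexpansive)] -/
theorem isAveraged_half_prox [FiniteDimensional ℝ E] {f : E → ℝ} (hf : ConvexOn ℝ univ f) :
    IsAveraged (1 / 2) (prox f) :=
  isAveraged_half_iff.2 (norm_prox_sub_prox_sq_le hf)

/-- The metric projection onto a nonempty complete convex set is `1/2`-averaged (firmly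
nonexpansive; `P_K = J_{N_K}`). [cite: Deutsch2001, Thm 5.5 (2); CombettesYamada2015, §4] -/
theorem isAveraged_half_proj {K : Set E} (hne : K.Nonempty) (hc : IsComplete K)
    (hK : Convex ℝ K) : IsAveraged (1 / 2) (proj K) :=
  isAveraged_half_iff.2 (norm_proj_sub_proj_sq_le_inner hne hc hK)

/-- For a `μ`-cocoercive `B` (`μ > 0`), the reflected step `I − 2μB` is nonexpansive.
[cite: WachsmuthWachsmuth2022, Lemma 2.3 (i)⇔(ii)] -/
theorem norm_reflStep_sub_le_of_isCocoercive {μ : ℝ} {B : E → E} (h : IsCocoercive μ B)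
    (hμ : 0 ≤ μ) (x y : E) : ‖(x - (2 * μ) • B x) - (y - (2 * μ) • B y)‖ ≤ ‖x - y‖ := by
  rw [← sq_le_sq₀ (norm_nonneg _) (norm_nonneg _)]
  have e : (x - (2 * μ) • B x) - (y - (2 * μ) • B y) = (x - y) - (2 * μ) • (B x - B y) := by
    simp only [smul_sub]; abel
  rw [e, norm_sub_sq_real, norm_smul, real_inner_smul_right, Real.norm_eq_abs, mul_pow, sq_abs]
  have h1 := h x y
  nlinarith [h1, mul_nonneg hμ (sq_nonneg ‖B x - B y‖)]

/-- THE FORWARD STEP IS AVERAGED [CY15, proof of Prop. 4.4: "`T₂ = I − γB` is `γ/(2β)`-averaged"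
for `β`-cocoercive `B` and `γ ∈ ]0, 2β]`]: for a `μ`-cocoercive `B` with `μ > 0` and
`0 ≤ γ ≤ 2μ`... stated for all real `γ` — only `μ ≠ 0` is used in the algebra, the range of `γ`
matters for `γ/(2μ) ∈ [0, 1]`: `I − γB = (1 − γ/(2μ)) I + (γ/(2μ))(I − 2μB)`.
[cite: CombettesYamada2015, proof of Prop 4.4 (T_{2,n} = I − γ_n B is γ_n/(2β)-averaged); BauschkeCombettes2010, Remark 2.2 (c)] -/
theorem isAveraged_forwardStep_of_isCocoercive {μ : ℝ} {B : E → E} (h : IsCocoercive μ B)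
    (hμ : 0 < μ) (γ : ℝ) : IsAveraged (γ / (2 * μ)) (fun x => x - γ • B x) := by
  refine ⟨fun x => x - (2 * μ) • B x, norm_reflStep_sub_le_of_isCocoercive h hμ.le, fun x => ?_⟩
  show x - γ • B x = (1 - γ / (2 * μ)) • x + (γ / (2 * μ)) • (x - (2 * μ) • B x)
  have hγ : γ / (2 * μ) * (2 * μ) = γ := by field_simp
  rw [smul_sub, smul_smul, hγ, sub_smul, one_smul]
  abel

section Gradient

variable [CompleteSpace E] {f : E → ℝ} {g : E → E}

/-- THE GRADIENT STEP IS AVERAGED: for a convex `f` with `L`-Lipschitz gradient `g = ∇f`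
(`L > 0`), `x ↦ x − γ ∇f x` is `γL/2`-averaged (Baillon–Haddad: `∇f` is `1/L`-cocoercive, then
the previous lemma). For `0 < γ < 2/L` the constant lies in `]0, 1[`.
[cite: BauschkeCombettes2010, Remark 2.2 (c); CombettesYamada2015, proof of Prop 4.4 with Prop 4.7] -/
theorem isAveraged_gradientStep (hf : ConvexOn ℝ univ f) (hg : ∀ x, HasGradientAt f (g x) x)
    {L : ℝ≥0} (hL : LipschitzWith L g) (hLpos : 0 < (L : ℝ)) (γ : ℝ) :
    IsAveraged (γ * L / 2) (fun x => x - γ • g x) := by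
  have hco : IsCocoercive (1 / (L : ℝ)) g := isCocoercive_of_convexOn hf hg hL
  have h := isAveraged_forwardStep_of_isCocoercive hco (by positivity) γ
  refine h.of_eq ?_
  field_simp

end Gradient

/-! ### Compositions and convex combinations -/

/-- The parallelogram-type inequality behind the composition rule:
`(st/(s + t))‖u + v‖² ≤ s‖u‖² + t‖v‖²` for `s, t ≥ 0` (with `st/(s+t) = 0` if `s = t = 0`),
since `(s + t)(s‖u‖² + t‖v‖²) − st‖u + v‖² = ‖su − tv‖² ≥ 0` (the identity used in the proof of [CY15, Prop. 2.4]).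
[folklore] -/
private theorem div_mul_norm_add_sq_le (u v : E) {s t : ℝ} (hs : 0 ≤ s) (ht : 0 ≤ t) :
    s * t / (s + t) * ‖u + v‖ ^ 2 ≤ s * ‖u‖ ^ 2 + t * ‖v‖ ^ 2 := by
  rcases (add_nonneg hs ht).eq_or_lt with hst | hst
  · rw [← hst, div_zero, zero_mul]; positivity
  rw [div_mul_eq_mul_div, div_le_iff₀ hst]
  have key : (s * ‖u‖ ^ 2 + t * ‖v‖ ^ 2) * (s + t) - s * t * ‖u + v‖ ^ 2 = ‖s • u - t • v‖ ^ 2 := by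
    rw [norm_add_sq_real, norm_sub_sq_real, norm_smul, norm_smul, real_inner_smul_left,
      real_inner_smul_right, Real.norm_eq_abs, Real.norm_eq_abs, mul_pow, mul_pow, sq_abs, sq_abs]
    ring
  nlinarith [key, sq_nonneg ‖s • u - t • v‖]

/-- The `ν`-form of averagedness used in the composition proof:
`‖T x − T y‖² + ν‖(x − T x) − (y − T y)‖² ≤ ‖x − y‖²` ([CY15, Prop. 2.1 (iii)] with
`ν = (1 − α)/α`). [cite: CombettesYamada2015, Prop 2.1 (iii)] -/
theorem IsAveraged.norm_sq_add_le (h : IsAveraged α T) (hα : 0 < α) (x y : E) :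
    ‖T x - T y‖ ^ 2 + (1 - α) / α * ‖(x - T x) - (y - T y)‖ ^ 2 ≤ ‖x - y‖ ^ 2 := by
  have h1 := (isAveraged_iff_norm_sq hα).1 h x y
  have key : ‖T x - T y‖ ^ 2 + (1 - α) / α * ‖(x - T x) - (y - T y)‖ ^ 2 =
      (α * ‖T x - T y‖ ^ 2 + (1 - α) * ‖(x - T x) - (y - T y)‖ ^ 2) / α := by
    field_simp
  rw [key, div_le_iff₀ hα]
  linarith

/-- Converse of the `ν`-form: if `‖T x − T y‖² + ν‖(x − T x) − (y − T y)‖² ≤ ‖x − y‖²` for all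
`x, y` with `ν ≥ 0`, then `T` is `1/(1 + ν)`-averaged. [cite: CombettesYamada2015, Prop 2.1 (iii)⇒(i)] -/
theorem isAveraged_of_norm_sq_add_le {ν : ℝ} (hν : 0 ≤ ν)
    (h : ∀ x y, ‖T x - T y‖ ^ 2 + ν * ‖(x - T x) - (y - T y)‖ ^ 2 ≤ ‖x - y‖ ^ 2) :
    IsAveraged (1 / (1 + ν)) T := by
  have hν1 : 0 < 1 + ν := by linarith
  rw [isAveraged_iff_norm_sq (by positivity)]
  intro x y
  have hne : (1 + ν) ≠ 0 := hν1.ne'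
  rw [one_sub_div hne, add_sub_cancel_left]
  simp only [div_mul_eq_mul_div, one_mul]
  rw [← add_div]
  exact div_le_div_of_nonneg_right (h x y) hν1.le

/-- The constant in the composition rule: with `νᵢ = (1 − αᵢ)/αᵢ` and `ν = ν₁ν₂/(ν₁ + ν₂)`,
`1/(1 + ν) = (α₁ + α₂ − 2α₁α₂)/(1 − α₁α₂)`. [folklore] -/
private theorem comp_const (h1 : 0 < α₁) (h1' : α₁ < 1) (h2 : 0 < α₂) (h2' : α₂ < 1) :
    1 / (1 + (1 - α₂) / α₂ * ((1 - α₁) / α₁) / ((1 - α₂) / α₂ + (1 - α₁) / α₁)) =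
      (α₁ + α₂ - 2 * α₁ * α₂) / (1 - α₁ * α₂) := by
  have hα₁ : α₁ ≠ 0 := h1.ne'
  have hα₂ : α₂ ≠ 0 := h2.ne'
  have hd' : 1 - α₁ * α₂ ≠ 0 := by nlinarith
  have hd : α₁ + α₂ - 2 * α₁ * α₂ ≠ 0 := by nlinarith
  have hs : (1 - α₂) / α₂ + (1 - α₁) / α₁ = (α₁ + α₂ - 2 * α₁ * α₂) / (α₂ * α₁) := by
    rw [div_add_div _ _ hα₂ hα₁]; ring
  have hp : (1 - α₂) / α₂ * ((1 - α₁) / α₁) = ((1 - α₂) * (1 - α₁)) / (α₂ * α₁) := by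
    rw [div_mul_div_comm]
  rw [hs, hp, div_div_div_cancel_right₀ (mul_ne_zero hα₂ hα₁), add_div' _ _ _ hd, one_div_div,
    div_eq_div_iff ?_ hd']
  · ring
  · intro h0; nlinarith [h0]

/-- COMPOSITION OF AVERAGED OPERATORS [CY15, Prop. 2.4] (Ogura–Yamada 2002, Thm 3 (b), with a
different proof): if `T₁` is `α₁`-averaged and `T₂` is `α₂`-averaged with `α₁, α₂ ∈ ]0,1[`, then
`T₁ ∘ T₂` is `α`-averaged with `α = (α₁ + α₂ − 2α₁α₂)/(1 − α₁α₂) ∈ ]0,1[`.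
[cite: CombettesYamada2015, Prop 2.4] -/
theorem IsAveraged.comp (h₁ : IsAveraged α₁ T₁) (h₂ : IsAveraged α₂ T₂) (hα₁ : 0 < α₁)
    (hα₁1 : α₁ < 1) (hα₂ : 0 < α₂) (hα₂1 : α₂ < 1) :
    IsAveraged ((α₁ + α₂ - 2 * α₁ * α₂) / (1 - α₁ * α₂)) (T₁ ∘ T₂) := by
  set ν₁ := (1 - α₁) / α₁ with hν₁
  set ν₂ := (1 - α₂) / α₂ with hν₂
  have hν₁0 : 0 < ν₁ := by rw [hν₁]; exact div_pos (by linarith) hα₁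
  have hν₂0 : 0 < ν₂ := by rw [hν₂]; exact div_pos (by linarith) hα₂
  -- the `ν`-form estimate for the composition, with `ν = ν₁ν₂/(ν₁ + ν₂)`
  have key : ∀ x y, ‖(T₁ ∘ T₂) x - (T₁ ∘ T₂) y‖ ^ 2
      + ν₂ * ν₁ / (ν₂ + ν₁) * ‖(x - (T₁ ∘ T₂) x) - (y - (T₁ ∘ T₂) y)‖ ^ 2 ≤ ‖x - y‖ ^ 2 := by
    intro x y
    simp only [Function.comp]
    have a := h₁.norm_sq_add_le hα₁ (T₂ x) (T₂ y)
    have b := h₂.norm_sq_add_le hα₂ x y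
    have c := div_mul_norm_add_sq_le ((x - T₂ x) - (y - T₂ y))
      ((T₂ x - T₁ (T₂ x)) - (T₂ y - T₁ (T₂ y))) hν₂0.le hν₁0.le
    have e : (x - T₂ x) - (y - T₂ y) + ((T₂ x - T₁ (T₂ x)) - (T₂ y - T₁ (T₂ y))) =
        (x - T₁ (T₂ x)) - (y - T₁ (T₂ y)) := by abel
    rw [e] at c
    rw [← hν₁] at a; rw [← hν₂] at b
    linarith
  have h := isAveraged_of_norm_sq_add_le (T := T₁ ∘ T₂)
    (div_nonneg (mul_nonneg hν₂0.le hν₁0.le) (add_pos hν₂0 hν₁0).le) key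
  refine h.of_eq ?_
  rw [hν₁, hν₂]
  exact comp_const hα₁ hα₁1 hα₂ hα₂1

/-- Special case: the composition of two firmly nonexpansive (`1/2`-averaged) maps is
`2/3`-averaged. [cite: CombettesYamada2015, Prop 2.4 (α₁ = α₂ = 1/2)] -/
theorem IsAveraged.comp_half (h₁ : IsAveraged (1 / 2) T₁) (h₂ : IsAveraged (1 / 2) T₂) :
    IsAveraged (2 / 3) (T₁ ∘ T₂) :=
  (h₁.comp h₂ (by norm_num) (by norm_num) (by norm_num) (by norm_num)).of_eq (by norm_num)

/-- CONVEX COMBINATIONS [CY15, Prop. 2.2] (two operators; Ogura–Yamada 2002): if `Tᵢ` is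
`αᵢ`-averaged (`αᵢ > 0`) and `0 ≤ ω ≤ 1`, then `ω T₁ + (1 − ω) T₂` is
`(ωα₁ + (1 − ω)α₂)`-averaged. [cite: CombettesYamada2015, Prop 2.2] -/
theorem IsAveraged.convexCombo (h₁ : IsAveraged α₁ T₁) (h₂ : IsAveraged α₂ T₂) (hα₁ : 0 < α₁)
    (hα₂ : 0 < α₂) {ω : ℝ} (hω0 : 0 ≤ ω) (hω1 : ω ≤ 1) :
    IsAveraged (ω * α₁ + (1 - ω) * α₂) (fun x => ω • T₁ x + (1 - ω) • T₂ x) := by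
  obtain ⟨R₁, hR₁, hT₁⟩ := h₁
  obtain ⟨R₂, hR₂, hT₂⟩ := h₂
  set a := ω * α₁ + (1 - ω) * α₂ with ha
  have ha0 : 0 < a := by
    rw [ha]
    rcases hω0.eq_or_lt with h | h
    · rw [← h]; simpa using hα₂
    · nlinarith
  refine ⟨fun x => (ω * α₁ / a) • R₁ x + ((1 - ω) * α₂ / a) • R₂ x, fun x y => ?_, fun x => ?_⟩
  · -- nonexpansive: a convex combination with weights `ωα₁/a + (1 − ω)α₂/a = 1`
    have hw1 : 0 ≤ ω * α₁ / a := by positivity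
    have hw2 : 0 ≤ (1 - ω) * α₂ / a := div_nonneg (mul_nonneg (by linarith) hα₂.le) ha0.le
    have hsum : ω * α₁ / a + (1 - ω) * α₂ / a = 1 := by
      rw [← add_div, div_eq_one_iff_eq ha0.ne', ha]
    have e : (ω * α₁ / a) • R₁ x + ((1 - ω) * α₂ / a) • R₂ x
        - ((ω * α₁ / a) • R₁ y + ((1 - ω) * α₂ / a) • R₂ y)
        = (ω * α₁ / a) • (R₁ x - R₁ y) + ((1 - ω) * α₂ / a) • (R₂ x - R₂ y) := by
      simp only [smul_sub]; abel
    rw [e]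
    calc ‖(ω * α₁ / a) • (R₁ x - R₁ y) + ((1 - ω) * α₂ / a) • (R₂ x - R₂ y)‖
        ≤ ‖(ω * α₁ / a) • (R₁ x - R₁ y)‖ + ‖((1 - ω) * α₂ / a) • (R₂ x - R₂ y)‖ :=
          norm_add_le _ _
      _ = ω * α₁ / a * ‖R₁ x - R₁ y‖ + (1 - ω) * α₂ / a * ‖R₂ x - R₂ y‖ := by
          rw [norm_smul, norm_smul, Real.norm_of_nonneg hw1, Real.norm_of_nonneg hw2]
      _ ≤ ω * α₁ / a * ‖x - y‖ + (1 - ω) * α₂ / a * ‖x - y‖ := by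
          gcongr
          · exact hR₁ x y
          · exact hR₂ x y
      _ = ‖x - y‖ := by rw [← add_mul, hsum, one_mul]
  · show ω • T₁ x + (1 - ω) • T₂ x = (1 - a) • x + a • ((ω * α₁ / a) • R₁ x + ((1 - ω) * α₂ / a) • R₂ x)
    rw [hT₁ x, hT₂ x, smul_add, smul_add, smul_smul, smul_smul, smul_smul, smul_smul, smul_add,
      smul_smul, smul_smul]
    have e1 : a * (ω * α₁ / a) = ω * α₁ := by field_simp
    have e2 : a * ((1 - ω) * α₂ / a) = (1 - ω) * α₂ := by field_simp
    rw [e1, e2]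
    have e3 : (1 - a) = ω * (1 - α₁) + (1 - ω) * (1 - α₂) := by rw [ha]; ring
    rw [e3, add_smul]
    abel

/-! ### Fixed points and convergence of the Picard iteration of an averaged map -/

/-- An averaged map (`α ≠ 0`) has the same fixed points as its underlying nonexpansive map.
[cite: CombettesYamada2015, Def 1.1] -/
theorem eq_self_iff_of_eq_averagedMap (hT : T = averagedMap R α) (hα : α ≠ 0) :
    T x = x ↔ R x = x := by
  rw [hT]; exact averagedMap_eq_self_iff hα

/-- CONVERGENCE OF THE ITERATES OF AN AVERAGED MAP (finite dimension / proper space): if `T` is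
`α`-averaged with `0 < α < 1` and has a fixed point, then for every `x₀` the Picard iterates
`Tⁿ x₀` converge to a fixed point of `T` — the iteration IS the Krasnosel'skiĭ–Mann iteration
`x_{n+1} = (1 − α) x_n + α R x_n` of the nonexpansive `R`
(`Literature.Analysis.Convex.KrasnoselskijIteration.exists_tendsto_kmIter`); [CY15, Cor. 4.1]
restricted to constant operators, `λ_n ≡ 1`, no errors, and strong convergence in finite
dimension. [cite: CombettesYamada2015, Prop 3.4 (iii) (restricted: T_n ≡ T, λ_n ≡ 1, e_n ≡ 0, dim H < ∞); Berinde2007, Ch. 3, Thm 3.2] -/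
theorem IsAveraged.exists_tendsto_iterate [ProperSpace E] (h : IsAveraged α T) (hα0 : 0 < α)
    (hα1 : α < 1) (hfix : ∃ p, T p = p) (x₀ : E) :
    ∃ q, T q = q ∧ Tendsto (fun n => T^[n] x₀) atTop (𝓝 q) := by
  obtain ⟨R, hR, hT⟩ := h.exists_eq_averagedMap
  obtain ⟨p, hp⟩ := hfix
  have hpR : R p = p := (eq_self_iff_of_eq_averagedMap hT hα0.ne').1 hp
  obtain ⟨q, hq, hlim⟩ := exists_tendsto_kmIter hR ⟨p, hpR⟩ hα0 hα1 x₀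
  refine ⟨q, (eq_self_iff_of_eq_averagedMap hT hα0.ne').2 hq, ?_⟩
  have e : (fun n => T^[n] x₀) = kmIter R α x₀ := by
    funext n; rw [kmIter, hT]
  rw [e]; exact hlim

/-! ## Fermat's rule for `f₁ + f₂` with `f₂` differentiable -/

section Fermat

variable [CompleteSpace E] {f₁ f₂ : E → ℝ} {g : E → E} {s : Set E}

/-- FERMAT'S RULE FOR A SUM (convex `f₁`, differentiable `f₂`, relative to a convex set `s`):
if `x ∈ s` minimises `f₁ + f₂` on `s` and `f₂` has gradient `g x` at `x`, then `−g x` is a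
subgradient of `f₁` at `x` relative to `s`: `f₁ x + ⟪−g x, y − x⟫ ≤ f₁ y` for `y ∈ s`
(slope argument along `x + t(y − x)`, `t ↓ 0`). With `f₁ = 0` this is [Car21, Lemma 6.2 (⇒)];
for finite convex `f₁, f₂` on `ℝⁿ` it is [HUL01, D Thm 2.2.1 with Thm 4.1.1 and Cor 2.1.4]
(`0 ∈ ∂(f₁ + f₂)(x) = ∂f₁(x) + {∇f₂(x)}`).
[cite: HiriarturrutyLemarechal2001, Chap. D, Thm 2.2.1 + Thm 4.1.1 + Cor 2.1.4 (PDF pp. 176, 181, 174); Carlier2021, Lemma 6.2] -/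
theorem hasSubgradientWithinAt_neg_of_isMinOn_add (hs : Convex ℝ s) (hx : x ∈ s)
    (hf₁ : ConvexOn ℝ s f₁) (hmin : IsMinOn (f₁ + f₂) s x) (hg : HasGradientAt f₂ (g x) x) :
    HasSubgradientWithinAt f₁ s (-g x) x := by
  intro y hy
  -- the restriction of `f₂` to the segment and its derivative at `0`
  set φ : ℝ → ℝ := fun t ↦ f₂ (x + t • (y - x)) with hφ
  have hφd : HasDerivAt φ (⟪g x, y - x⟫) 0 := by
    have hline : HasDerivAt (fun t : ℝ ↦ x + t • (y - x)) (y - x) 0 := by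
      simpa using ((hasDerivAt_id (0 : ℝ)).smul_const (y - x)).const_add x
    have hd' : HasFDerivAt f₂ (toDual ℝ E (g x)) (x + (0 : ℝ) • (y - x)) := by
      rw [zero_smul, add_zero]; exact hg.hasFDerivAt
    have := hd'.comp_hasDerivAt 0 hline
    rw [toDual_apply_apply] at this
    exact this
  -- slopes of `φ` on `(0,1)` are bounded below by `f₁ x - f₁ y`
  have hslope : ∀ t ∈ Ioo (0 : ℝ) 1, f₁ x - f₁ y ≤ t⁻¹ • (φ (0 + t) - φ 0) := by
    intro t ht
    have hseg : x + t • (y - x) ∈ s := by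
      have := hs hx hy (by linarith [ht.2] : 0 ≤ 1 - t) ht.1.le (by ring)
      have hpt : (1 - t) • x + t • y = x + t • (y - x) := by
        simp only [sub_smul, one_smul, smul_sub]; abel
      rwa [hpt] at this
    have hconv := hf₁.2 hx hy (by linarith [ht.2] : 0 ≤ 1 - t) ht.1.le (by ring)
    have hpt : (1 - t) • x + t • y = x + t • (y - x) := by
      simp only [sub_smul, one_smul, smul_sub]; abel
    rw [hpt] at hconv
    simp only [smul_eq_mul] at hconv
    have hm := hmin hseg
    simp only [mem_setOf_eq, Pi.add_apply] at hm
    have hφ0 : φ 0 = f₂ x := by simp [hφ]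
    have hφt : φ (0 + t) = f₂ (x + t • (y - x)) := by simp [hφ]
    rw [hφ0, hφt, smul_eq_mul, ← div_eq_inv_mul, le_div_iff₀ ht.1]
    nlinarith [hconv, hm, ht.1]
  have htend : Tendsto (fun t ↦ t⁻¹ • (φ (0 + t) - φ 0)) (𝓝[>] 0) (𝓝 ⟪g x, y - x⟫) :=
    hφd.tendsto_slope_zero_right
  have hmem : Ioo (0 : ℝ) 1 ∈ 𝓝[>] (0 : ℝ) := Ioo_mem_nhdsGT zero_lt_one
  have hle : f₁ x - f₁ y ≤ ⟪g x, y - x⟫ :=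
    ge_of_tendsto htend (by filter_upwards [hmem] with t ht using hslope t ht)
  rw [inner_neg_left]
  linarith

/-- The converse (sufficiency), for `f₂` convex on `s`: if `−g x` is a subgradient of `f₁` at
`x ∈ s` relative to `s` and `f₂` (convex on `s`) has gradient `g x` at `x`, then `x` minimises
`f₁ + f₂` on `s` (add the subgradient inequality to the tangent inequality
`f₂ x + ⟪g x, y − x⟫ ≤ f₂ y`). [cite: HiriarturrutyLemarechal2001, Chap. D, Thm 2.2.1 (ii)⇒(i) (PDF p. 176); Carlier2021, Lemma 6.2] -/
theorem isMinOn_add_of_hasSubgradientWithinAt_neg (hx : x ∈ s) (hf₂ : ConvexOn ℝ s f₂)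
    (hp : HasSubgradientWithinAt f₁ s (-g x) x) (hg : HasGradientAt f₂ (g x) x) :
    IsMinOn (f₁ + f₂) s x := by
  intro y hy
  simp only [mem_setOf_eq, Pi.add_apply]
  have h1 := hp y hy
  have h2 := ConvexOn.apply_add_fderiv_le hf₂ hx hg.hasFDerivAt hy
  rw [toDual_apply_apply] at h2
  rw [inner_neg_left] at h1
  linarith

/-- FERMAT'S RULE, `iff` form: for `f₁, f₂` convex on a convex set `s`, `x ∈ s`, and `f₂` with
gradient `g x` at `x`: `x` minimises `f₁ + f₂` on `s` iff `−∇f₂(x) ∈ ∂f₁(x)` (relative to `s`).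
[cite: HiriarturrutyLemarechal2001, Chap. D, Thm 2.2.1 + Thm 4.1.1 + Cor 2.1.4 (PDF pp. 176, 181, 174); Carlier2021, §7.4.1 (optimality condition for (7.51))] -/
theorem isMinOn_add_iff_hasSubgradientWithinAt_neg (hs : Convex ℝ s) (hx : x ∈ s)
    (hf₁ : ConvexOn ℝ s f₁) (hf₂ : ConvexOn ℝ s f₂) (hg : HasGradientAt f₂ (g x) x) :
    IsMinOn (f₁ + f₂) s x ↔ HasSubgradientWithinAt f₁ s (-g x) x :=
  ⟨fun h => hasSubgradientWithinAt_neg_of_isMinOn_add hs hx hf₁ h hg,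
    fun h => isMinOn_add_of_hasSubgradientWithinAt_neg hx hf₂ h hg⟩

/-- The smooth constrained case (`f₁ = 0`), [Car21, Lemma 6.2]: for `f` convex on a convex `K`
with gradient `g x` at `x ∈ K`, `x` minimises `f` on `K` iff the VARIATIONAL INEQUALITY
`0 ≤ ⟪∇f x, y − x⟫` holds for all `y ∈ K`. [cite: Carlier2021, Lemma 6.2] -/
theorem isMinOn_iff_inner_nonneg {f : E → ℝ} {K : Set E} (hK : Convex ℝ K) (hx : x ∈ K)
    (hf : ConvexOn ℝ K f) (hg : HasGradientAt f (g x) x) :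
    IsMinOn f K x ↔ ∀ y ∈ K, 0 ≤ ⟪g x, y - x⟫ := by
  have h := isMinOn_add_iff_hasSubgradientWithinAt_neg (f₁ := fun _ => (0:ℝ)) (f₂ := f) hK hx
    (convexOn_const 0 hK) hf hg
  have e : ((fun _ => (0:ℝ)) + f) = f := by funext z; simp
  rw [e] at h
  rw [h, hasSubgradientWithinAt_iff]
  refine forall_congr' fun y => forall_congr' fun hy => ?_
  rw [inner_neg_left]
  constructor <;> intro h' <;> linarith

end Fermat

/-! ## Forward–backward splitting (the proximal gradient method) in finite dimension -/

section ForwardBackward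

variable [FiniteDimensional ℝ E] {f₁ f₂ : E → ℝ} {g : E → E} {γ : ℝ}

/-- The FORWARD–BACKWARD (proximal gradient) operator
`T = prox_{γ f₁} ∘ (I − γ ∇f₂)`: `x ↦ prox_{γ f₁}(x − γ g x)` ([CY15, Prop. 4.7] with `λ_n ≡ 1`,
no errors; [Car21, (7.52)], "ISTA"). [cite: Carlier2021, §7.4.1 (7.52); CombettesYamada2015, Prop 4.7 (iteration, λ_n ≡ 1, a_n = b_n = 0)] -/
def fbStep (γ : ℝ) (f₁ : E → ℝ) (g : E → E) (x : E) : E := prox (γ • f₁) (x - γ • g x)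

omit [FiniteDimensional ℝ E] in
/-- Unfolding lemma. [cite: Carlier2021, §7.4.1 (7.52)] -/
theorem fbStep_apply (γ : ℝ) (f₁ : E → ℝ) (g : E → E) (x : E) :
    fbStep γ f₁ g x = prox (γ • f₁) (x - γ • g x) := rfl

omit [FiniteDimensional ℝ E] in
/-- `fbStep` is the composition of the backward (proximal) and the forward (gradient) step.
[cite: Carlier2021, §7.4.1 (7.52)] -/
theorem fbStep_eq_comp (γ : ℝ) (f₁ : E → ℝ) (g : E → E) :
    fbStep γ f₁ g = prox (γ • f₁) ∘ fun x => x - γ • g x := rfl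

omit [FiniteDimensional ℝ E] in
/-- Scaling subgradients: for `γ > 0`, `γ p ∈ ∂(γ f)(x) ⟺ p ∈ ∂f(x)`
([HUL01, D Thm 4.1.1] with one summand). [cite: HiriarturrutyLemarechal2001, Chap. D, Thm 4.1.1 (PDF p. 181)] -/
theorem hasSubgradientWithinAt_smul_iff {f : E → ℝ} {s : Set E} {p x : E} (hγ : 0 < γ) :
    HasSubgradientWithinAt (γ • f) s (γ • p) x ↔ HasSubgradientWithinAt f s p x := by
  simp only [hasSubgradientWithinAt_iff, Pi.smul_apply, smul_eq_mul, real_inner_smul_left]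
  refine forall_congr' fun y => forall_congr' fun hy => ?_
  constructor
  · intro h; nlinarith [h]
  · intro h; nlinarith [h]

/-- FIXED POINTS OF THE FORWARD–BACKWARD OPERATOR, operator form: for `f₁` convex and `γ > 0`,
`prox_{γf₁}(x − γ g x) = x ⟺ −g x ∈ ∂f₁(x)` ([CY15, proof of Prop. 4.4]: `zer(A + B) = Fix(J_{γA}(I − γB))`
with `A = ∂f₁`, `B = g`; [Car21, §7.4.1]: "`x = prox_{ρg}(x − ρ∇f(x))` … i.e.
`0 ∈ ∂g(x) + ∇f(x)`"). [cite: Carlier2021, §7.4.1 (after (7.52)); CombettesYamada2015, proof of Prop 4.4 (zer(A+B) = Fix(T_{1,n}T_{2,n}))] -/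
theorem fbStep_eq_self_iff (hf₁ : ConvexOn ℝ univ f₁) (hγ : 0 < γ) :
    fbStep γ f₁ g x = x ↔ HasSubgradientWithinAt f₁ univ (-g x) x := by
  have hc : ConvexOn ℝ univ (γ • f₁) := hf₁.smul hγ.le
  rw [fbStep_apply, prox_eq_iff hc]
  have e : x - γ • g x - x = γ • (-g x) := by rw [smul_neg]; abel
  rw [e, hasSubgradientWithinAt_smul_iff hγ]

/-- FIXED POINTS = MINIMISERS: for `f₁, f₂` convex, `f₂` with gradient `g`, and `γ > 0`,
`prox_{γf₁}(x − γ∇f₂ x) = x ⟺ x ∈ argmin (f₁ + f₂)` ([CY15, Prop. 4.7 via the proof of Prop. 4.4];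
[Car21, §7.4.1]: the fixed-point equation "is the optimality condition for (7.51)").
[cite: Carlier2021, §7.4.1 (optimality condition for (7.51)); CombettesYamada2015, Prop 4.7] -/
theorem fbStep_eq_self_iff_isMinOn (hf₁ : ConvexOn ℝ univ f₁) (hf₂ : ConvexOn ℝ univ f₂)
    (hg : ∀ x, HasGradientAt f₂ (g x) x) (hγ : 0 < γ) :
    fbStep γ f₁ g x = x ↔ IsMinOn (f₁ + f₂) univ x := by
  rw [fbStep_eq_self_iff hf₁ hγ,
    isMinOn_add_iff_hasSubgradientWithinAt_neg convex_univ (mem_univ x) hf₁ hf₂ (hg x)]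

/-- The forward–backward operator is NONEXPANSIVE for `0 ≤ γ ≤ 2/L` (`f₂` convex with
`L`-Lipschitz gradient): `prox` is nonexpansive and so is the gradient step (Baillon–Haddad).
[cite: Carlier2021, §7.4.1 (prox_{ρg} is 1-Lipschitz); CombettesYamada2015, Prop 4.7] -/
theorem norm_fbStep_sub_fbStep_le (hf₁ : ConvexOn ℝ univ f₁) (hf₂ : ConvexOn ℝ univ f₂)
    (hg : ∀ x, HasGradientAt f₂ (g x) x) {L : ℝ≥0} (hL : LipschitzWith L g) (hγ0 : 0 ≤ γ)
    (hγ : γ ≤ 2 / (L : ℝ)) (x y : E) : ‖fbStep γ f₁ g x - fbStep γ f₁ g y‖ ≤ ‖x - y‖ := by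
  have hc : ConvexOn ℝ univ (γ • f₁) := hf₁.smul hγ0
  rw [fbStep_apply, fbStep_apply]
  exact (norm_prox_sub_prox_le hc _ _).trans (norm_gradientStep_sub_le hf₂ hg hL hγ0 hγ x y)

/-- THE FORWARD–BACKWARD OPERATOR IS AVERAGED [CY15, Remark 4.6 and the proof of Prop. 4.4 /
Prop. 4.7; Com18, §4.1: "`T = J_{γA} ∘ (I − γB)` is averaged with constant `2/(4 − βγ)`"]:
for `f₁, f₂` convex, `f₂` with `L`-Lipschitz gradient (`L > 0`) and `0 < γ < 2/L`,
`prox_{γf₁} ∘ (I − γ∇f₂)` is `2/(4 − γL)`-averaged (composition of the `1/2`-averaged `prox`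
with the `γL/2`-averaged gradient step). [cite: CombettesYamada2015, Remark 4.6 (α = 2β/(4β − γ)); Combettes2018, §4.1] -/
theorem isAveraged_fbStep (hf₁ : ConvexOn ℝ univ f₁) (hf₂ : ConvexOn ℝ univ f₂)
    (hg : ∀ x, HasGradientAt f₂ (g x) x) {L : ℝ≥0} (hL : LipschitzWith L g)
    (hLpos : 0 < (L : ℝ)) (hγ0 : 0 < γ) (hγ : γ < 2 / (L : ℝ)) :
    IsAveraged (2 / (4 - γ * L)) (fbStep γ f₁ g) := by
  have hc : ConvexOn ℝ univ (γ • f₁) := hf₁.smul hγ0.le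
  have h₁ : IsAveraged (1 / 2) (prox (γ • f₁)) := isAveraged_half_prox hc
  have h₂ : IsAveraged (γ * L / 2) (fun x => x - γ • g x) := isAveraged_gradientStep hf₂ hg hL hLpos γ
  have hγL : γ * L < 2 := by
    have := (lt_div_iff₀ hLpos).1 hγ; linarith
  have h := h₁.comp h₂ (by norm_num) (by norm_num) (by positivity) (by linarith)
  rw [fbStep_eq_comp]
  refine h.of_eq ?_
  have hd : 4 - γ * L ≠ 0 := by linarith
  have hd2 : (1:ℝ) - 1 / 2 * (γ * L / 2) ≠ 0 := by intro h0; apply hd; linarith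
  rw [div_eq_div_iff hd2 hd]
  ring

/-- CONVERGENCE OF THE PROXIMAL GRADIENT METHOD [CY15, Prop. 4.7 (iii)] restricted to finite
dimension, finite-valued `f₁`, a constant step `γ ∈ ]0, 2/L[`, relaxation `λ_n ≡ 1` and no
errors: if `f₁, f₂ : E → ℝ` are convex, `f₂` has `L`-Lipschitz gradient `g` (`L > 0`) and
`f₁ + f₂` has a minimiser, then for every `x₀` the iterates `x_{n+1} = prox_{γf₁}(x_n − γ∇f₂ x_n)`
converge to a minimiser of `f₁ + f₂`. [cite: CombettesYamada2015, Prop 4.7 (iii) (restricted: dim H < ∞, f finite, γ_n ≡ γ, λ_n ≡ 1, a_n = b_n = 0)] -/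
theorem exists_isMinOn_tendsto_iterate_fbStep (hf₁ : ConvexOn ℝ univ f₁) (hf₂ : ConvexOn ℝ univ f₂)
    (hg : ∀ x, HasGradientAt f₂ (g x) x) {L : ℝ≥0} (hL : LipschitzWith L g)
    (hLpos : 0 < (L : ℝ)) (hγ0 : 0 < γ) (hγ : γ < 2 / (L : ℝ))
    (hmin : ∃ x, IsMinOn (f₁ + f₂) univ x) (x₀ : E) :
    ∃ xs, IsMinOn (f₁ + f₂) univ xs ∧ Tendsto (fun n => (fbStep γ f₁ g)^[n] x₀) atTop (𝓝 xs) := by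
  have hav := isAveraged_fbStep hf₁ hf₂ hg hL hLpos hγ0 hγ
  have hγL : γ * L < 2 := by
    have := (lt_div_iff₀ hLpos).1 hγ; linarith
  have hγL0 : 0 < γ * L := by positivity
  have hα0 : 0 < 2 / (4 - γ * L) := by apply div_pos <;> linarith
  have hα1 : 2 / (4 - γ * L) < 1 := by rw [div_lt_one] <;> linarith
  obtain ⟨p, hp⟩ := hmin
  have hfix : ∃ p, fbStep γ f₁ g p = p := ⟨p, (fbStep_eq_self_iff_isMinOn hf₁ hf₂ hg hγ0).2 hp⟩
  obtain ⟨q, hq, hlim⟩ := hav.exists_tendsto_iterate hα0 hα1 hfix x₀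
  exact ⟨q, (fbStep_eq_self_iff_isMinOn hf₁ hf₂ hg hγ0).1 hq, hlim⟩

end ForwardBackward

/-! ## The projected gradient method -/

section ProjectedGradient

variable [CompleteSpace E] {f : E → ℝ} {g : E → E} {K : Set E} {γ : ℝ}

/-- The PROJECTED GRADIENT operator `x ↦ P_K(x − γ ∇f x)` ([Car21, (7.17)]; the forward–backward
operator with `A = N_K`, `J_{γ N_K} = P_K`). [cite: Carlier2021, §7.3 (7.17)] -/
def projGradStep (γ : ℝ) (K : Set E) (g : E → E) (x : E) : E := proj K (x - γ • g x)

omit [CompleteSpace E] in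
/-- Unfolding lemma. [cite: Carlier2021, §7.3 (7.17)] -/
theorem projGradStep_apply (γ : ℝ) (K : Set E) (g : E → E) (x : E) :
    projGradStep γ K g x = proj K (x - γ • g x) := rfl

omit [CompleteSpace E] in
/-- FIXED POINTS OF THE PROJECTED GRADIENT OPERATOR = SOLUTIONS OF THE VARIATIONAL INEQUALITY
[Car21, (7.16)]: for `K` nonempty complete convex and `γ > 0`,
`P_K(x − γ g x) = x ⟺ x ∈ K ∧ ∀ y ∈ K, 0 ≤ ⟪g x, y − x⟫` (projection theorem).
[cite: Carlier2021, §7.3 (7.16)] -/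
theorem projGradStep_eq_self_iff (hne : K.Nonempty) (hc : IsComplete K) (hK : Convex ℝ K)
    (hγ : 0 < γ) : projGradStep γ K g x = x ↔ x ∈ K ∧ ∀ y ∈ K, 0 ≤ ⟪g x, y - x⟫ := by
  rw [projGradStep_apply, eq_comm, eq_proj_iff hne hc hK]
  refine and_congr Iff.rfl (forall_congr' fun y => forall_congr' fun hy => ?_)
  have e : x - γ • g x - x = -(γ • g x) := by abel
  rw [e, inner_neg_left, real_inner_smul_left, neg_nonpos, mul_nonneg_iff_of_pos_left hγ]

/-- FIXED POINTS = CONSTRAINED MINIMISERS [Car21, §7.3, (7.16) with Lemma 6.2]: for `f` convex on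
the nonempty complete convex `K` with gradient `g` and `γ > 0`,
`P_K(x − γ∇f x) = x ⟺ x ∈ K ∧ x minimises f on K`. [cite: Carlier2021, §7.3 (7.16) and Lemma 6.2] -/
theorem projGradStep_eq_self_iff_isMinOn (hne : K.Nonempty) (hc : IsComplete K) (hK : Convex ℝ K)
    (hf : ConvexOn ℝ K f) (hg : ∀ x, HasGradientAt f (g x) x) (hγ : 0 < γ) :
    projGradStep γ K g x = x ↔ x ∈ K ∧ IsMinOn f K x := by
  rw [projGradStep_eq_self_iff hne hc hK hγ]
  constructor
  · rintro ⟨hx, h⟩; exact ⟨hx, (isMinOn_iff_inner_nonneg hK hx hf (hg x)).2 h⟩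
  · rintro ⟨hx, h⟩; exact ⟨hx, (isMinOn_iff_inner_nonneg hK hx hf (hg x)).1 h⟩

/-- THE PROJECTED GRADIENT OPERATOR IS AVERAGED: for `f` convex on `E` with `L`-Lipschitz
gradient (`L > 0`), `K` nonempty complete convex and `0 < γ < 2/L`, `P_K ∘ (I − γ∇f)` is
`2/(4 − γL)`-averaged ([CY15, Remark 4.6] with `A = N_K`: `P_K` is `1/2`-averaged, the gradient step
`γL/2`-averaged). [cite: CombettesYamada2015, Remark 4.6 (A = N_K, J_{γA} = P_K); Combettes2018, §4.1] -/
theorem isAveraged_projGradStep (hne : K.Nonempty) (hc : IsComplete K) (hK : Convex ℝ K)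
    (hf : ConvexOn ℝ univ f) (hg : ∀ x, HasGradientAt f (g x) x) {L : ℝ≥0}
    (hL : LipschitzWith L g) (hLpos : 0 < (L : ℝ)) (hγ0 : 0 < γ) (hγ : γ < 2 / (L : ℝ)) :
    IsAveraged (2 / (4 - γ * L)) (projGradStep γ K g) := by
  have h₁ : IsAveraged (1 / 2) (proj K) := isAveraged_half_proj hne hc hK
  have h₂ : IsAveraged (γ * L / 2) (fun x => x - γ • g x) := isAveraged_gradientStep hf hg hL hLpos γ
  have hγL : γ * L < 2 := by
    have := (lt_div_iff₀ hLpos).1 hγ; linarith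
  have h := h₁.comp h₂ (by norm_num) (by norm_num) (by positivity) (by linarith)
  have e : projGradStep γ K g = proj K ∘ fun x => x - γ • g x := rfl
  rw [e]
  refine h.of_eq ?_
  have hd : 4 - γ * L ≠ 0 := by linarith
  have hd2 : (1:ℝ) - 1 / 2 * (γ * L / 2) ≠ 0 := by intro h0; apply hd; linarith
  rw [div_eq_div_iff hd2 hd]
  ring

/-- CONVERGENCE OF THE PROJECTED GRADIENT METHOD (finite dimension; [Car21, Thm 7.3] assumes strong
convexity and gets a contraction — here only convexity, via averagedness, as the case `A = N_K` of
[CY15, Prop. 4.4 (iii)]): for `f` convex on `E` with `L`-Lipschitz gradient (`L > 0`), `K`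
nonempty closed convex, `0 < γ < 2/L`, and `f` having a minimiser on `K`, the iterates
`x_{n+1} = P_K(x_n − γ∇f x_n)` converge to a minimiser of `f` on `K`.
[cite: CombettesYamada2015, Prop 4.4 (iii) (A = N_K; restricted: dim H < ∞, γ_n ≡ γ, λ_n ≡ 1, no errors); Carlier2021, Thm 7.3 (cf.)] -/
theorem exists_isMinOn_tendsto_iterate_projGradStep [FiniteDimensional ℝ E] (hne : K.Nonempty)
    (hcl : IsClosed K) (hK : Convex ℝ K) (hf : ConvexOn ℝ univ f)
    (hg : ∀ x, HasGradientAt f (g x) x) {L : ℝ≥0} (hL : LipschitzWith L g)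
    (hLpos : 0 < (L : ℝ)) (hγ0 : 0 < γ) (hγ : γ < 2 / (L : ℝ))
    (hmin : ∃ x ∈ K, IsMinOn f K x) (x₀ : E) :
    ∃ xs ∈ K, IsMinOn f K xs ∧ Tendsto (fun n => (projGradStep γ K g)^[n] x₀) atTop (𝓝 xs) := by
  have hc : IsComplete K := hcl.isComplete
  have hav := isAveraged_projGradStep hne hc hK hf hg hL hLpos hγ0 hγ
  have hγL : γ * L < 2 := by
    have := (lt_div_iff₀ hLpos).1 hγ; linarith
  have hγL0 : 0 < γ * L := by positivity
  have hα0 : 0 < 2 / (4 - γ * L) := by apply div_pos <;> linarith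
  have hα1 : 2 / (4 - γ * L) < 1 := by rw [div_lt_one] <;> linarith
  have hfK : ConvexOn ℝ K f := hf.subset (subset_univ K) hK
  obtain ⟨p, hpK, hp⟩ := hmin
  have hfix : ∃ p, projGradStep γ K g p = p :=
    ⟨p, (projGradStep_eq_self_iff_isMinOn hne hc hK hfK hg hγ0).2 ⟨hpK, hp⟩⟩
  obtain ⟨q, hq, hlim⟩ := hav.exists_tendsto_iterate hα0 hα1 hfix x₀
  obtain ⟨hqK, hqmin⟩ := (projGradStep_eq_self_iff_isMinOn hne hc hK hfK hg hγ0).1 hq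
  exact ⟨q, hqK, hqmin, hlim⟩

end ProjectedGradient

end Literature.Analysis.Convex.AveragedOperators
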